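import Summits.AtomisticToContinuum.Crystallization.Theorems.PricedLinkCensusTruncatedCensusGapDefectFarLocality
import Summits.AtomisticToContinuum.Crystallization.Theorems.PricedLinkCensusTruncatedCensusGapFarPeriodicBlocks

/-!
# The defect far-site gap (FAR₂) implies a periodic defect-far-site pricing

Helper (FAR₂-PERIODIC FORM, part 2 of 3: blocks) for the registered sub-goal
`defectFarSiteGap_iff_periodicDefectFarPricing` of the stub `stub_defectFarSiteGap` (FAR₂, the
open core) of the line `elastic-basin-split`
(`Cruxes/TruncatedCensusGap/Lines/elastic_basin_split.lean`) of the crux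
`PricedLinkCensus.TruncatedCensusGap` (item stmt-AtomisticToContinuum-14230); the PORT to the
near₂ predicate of `periodicFarPricing_of_farSiteGap` (`…FarPeriodicBlocks.lean`, line
`near-far-split`), itself the twin of `periodicUnderPricing_of_underCoordinationGap` and of
`periodicPricing_of_truncatedCensusGap` (`…CruxForms.lean`).  Write
`V_χ r = min 1 (max 0 (4 - 2r)) · V_LJ r` for the range-2 truncated Lennard-Jones potential,
`e_χ* = ⨅_Q e_χ(Q)` for the infimum of its energy per particle over periodic configurations of
`ℝ³`, and call a site `i` of a configuration `y : ι → ℝ³` NEAR₂ when its `a₀/2`-separated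
closed `3a₀`-patch (`a₀ = 977/1000`) is two-way `a₀/8`-matched to the reference points
`g (F z)`, `z ∈ barlowStacking 1 √(2/3) s` (`s` a Hägg word, `F` a linear strain with
`‖F v - a₀ • v‖ ≤ (a₀/10) ‖v‖`, `g` a rigid motion) — the predicate `∃ s F g, …` inlined in the
stub and spelled out in every statement below (see `…DefectFarLocality.lean`); DEFECT-FAR = not
near₂, `Far₂(y) = {i | ¬ ∃ s F g, …}`.  The stub (FAR₂) reads
`∃ κ > 0, ∀ N (y : Fin N → ℝ³) injective, N · e_χ* + κ · #Far₂(y) ≤ E_χ(y)`.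

**Theorem (`periodicDefectFarPricing_of_defectFarSiteGap`).**  (FAR₂) implies, with the same
`κ`, the PERIODIC DEFECT-FAR-SITE PRICING
`∀ Q : PeriodicConfiguration 3, κ · #{motif sites of Q that are defect-far in Q.points} ≤ #F · (e_χ(Q) − e_χ*)`
(defect-far being read in the infinite point set `Q.points`, configuration `Subtype.val`): the
blocks `blockConfig Q K` are `V_χ`-trial states (`exists_block_energy_le_truncLJ`); by
FAR₂-LOCALITY (`nearBasin_apply_iff_comp`, radius `357/100 < 4`) and the template's
`mem_range_toP_of_deep`, `(depth Q 4)`-deep block points are defect-far in the block iff they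
are defect-far in `Q` (`dfar_block_iff`), and by translation invariance
(`nearBasin_transl_iff`) iff their motif point is defect-far in `Q`; so the block has at least
`#deep · #Far₂-motif(Q)` defect-far sites (`dfar_card_block_ge`), non-deep lattice coordinates
being `≤ 6 · depth · K²` (`Blocks.card_deep_ge`); the potential-free arithmetic is the
template's `pricing_of_blockEstimates` (both reused, whence the import of
`…FarPeriodicBlocks.lean`).  The converse and the equivalence are part 3
(`…DefectFarPeriodicForm.lean`).

Margin ledger: locality radius `357/100 < 4 =` block depth scale (unchanged from the template).
All `[folklore]` bookkeeping; the content of (FAR₂) is untouched.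
-/

noncomputable section

namespace Summit.AtomisticToContinuum.Crystallization.Theorems.PricedLinkCensusTruncatedCensusGap

open Literature.MathematicalPhysics.StatisticalMechanics Literature.Geometry.DiscreteGeometry
open Summit.AtomisticToContinuum.Crystallization.Theorems.ChargedEnergyGapNegative
open Summit.AtomisticToContinuum.Crystallization.Theorems.ChargedEnergyGapNegative.Blocks

/-! ## Defect-far sites under re-indexing -/

/-- Re-indexing the sites by an equivalence preserves the number of defect-far sites.
[folklore] -/
theorem dfar_card_comp_equiv {ι κ : Type*} (y : ι → EuclideanSpace ℝ (Fin 3)) (e : κ ≃ ι) :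
    Nat.card {i : κ // ¬ ∃ (s : ℤ → ℤ) (F : EuclideanSpace ℝ (Fin 3) →L[ℝ] EuclideanSpace ℝ (Fin 3)) (g : EuclideanSpace ℝ (Fin 3) ≃ᵃⁱ[ℝ] EuclideanSpace ℝ (Fin 3)), Literature.MathematicalPhysics.StatisticalMechanics.IsHaggSeq s ∧ (∀ v : EuclideanSpace ℝ (Fin 3), ‖F v - (977 / 1000 : ℝ) • v‖ ≤ 977 / 10000 * ‖v‖) ∧ (∀ j k, j ≠ k → dist ((y ∘ ⇑e) j) ((y ∘ ⇑e) i) ≤ 2931 / 1000 → 977 / 2000 ≤ dist ((y ∘ ⇑e) j) ((y ∘ ⇑e) k)) ∧ (∀ j, dist ((y ∘ ⇑e) j) ((y ∘ ⇑e) i) ≤ 2931 / 1000 → ∃ z ∈ Literature.MathematicalPhysics.StatisticalMechanics.barlowStacking 1 (Real.sqrt (2 / 3)) s, dist ((y ∘ ⇑e) j) (g (F z)) ≤ 977 / 8000) ∧ (∀ z ∈ Literature.MathematicalPhysics.StatisticalMechanics.barlowStacking 1 (Real.sqrt (2 / 3)) s, dist (g (F z)) ((y ∘ ⇑e) i) ≤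 2931 / 1000 → ∃ j, dist ((y ∘ ⇑e) j) (g (F z)) ≤ 977 / 8000)} =
      Nat.card {i : ι // ¬ ∃ (s : ℤ → ℤ) (F : EuclideanSpace ℝ (Fin 3) →L[ℝ] EuclideanSpace ℝ (Fin 3)) (g : EuclideanSpace ℝ (Fin 3) ≃ᵃⁱ[ℝ] EuclideanSpace ℝ (Fin 3)), Literature.MathematicalPhysics.StatisticalMechanics.IsHaggSeq s ∧ (∀ v : EuclideanSpace ℝ (Fin 3), ‖F v - (977 / 1000 : ℝ) • v‖ ≤ 977 / 10000 * ‖v‖) ∧ (∀ j k, j ≠ k → dist (y j) (y i) ≤ 2931 / 1000 → 977 / 2000 ≤ dist (y j) (y k)) ∧ (∀ j, dist (y j) (y i) ≤ 2931 / 1000 → ∃ z ∈ Literature.MathematicalPhysics.StatisticalMechanics.barlowStacking 1 (Real.sqrt (2 / 3)) s, dist (y j) (g (F z)) ≤ 977 / 8000) ∧ (∀ z ∈ Literature.MathematicalPhysics.StatisticalMechanics.barlowStacking 1 (Real.sqrt (2 / 3)) s, dist (g (F z)) (y i) ≤ 2931 / 1000 → ∃ j, dist (y j) (g (F z)) ≤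 977 / 8000)} :=
  Nat.card_congr (e.subtypeEquiv fun i => not_congr (nearBasin_comp_equiv_iff y e i))

/-! ## Blocks: deep block points over defect-far motif points are defect-far -/

section BlockCount

variable (Q : PeriodicConfiguration 3) (K : ℕ)

/-- **Translation invariance of the near₂ predicate in `Q`.** [folklore] -/
theorem nearBasin_transl_iff {t : E3} (ht : t ∈ Q.lattice) (p : Q.points) :
    (∃ (s : ℤ → ℤ) (F : EuclideanSpace ℝ (Fin 3) →L[ℝ] EuclideanSpace ℝ (Fin 3)) (g : EuclideanSpace ℝ (Fin 3) ≃ᵃⁱ[ℝ] EuclideanSpace ℝ (Fin 3)), Literature.MathematicalPhysics.StatisticalMechanics.IsHaggSeq s ∧ (∀ v : EuclideanSpace ℝ (Fin 3), ‖F v - (977 / 1000 : ℝ) • v‖ ≤ 977 / 10000 * ‖v‖) ∧ (∀ j k, j ≠ k → dist ((ptConfig Q) j) ((ptConfig Q) (transl Q ht p)) ≤ 2931 / 1000 → 977 / 2000 ≤ dist ((ptConfig Q) j) ((ptConfig Q) k)) ∧ (∀ j, dist ((ptConfig Q) j) ((ptConfig Q) (transl Q ht p)) ≤ 2931 / 1000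 → ∃ z ∈ Literature.MathematicalPhysics.StatisticalMechanics.barlowStacking 1 (Real.sqrt (2 / 3)) s, dist ((ptConfig Q) j) (g (F z)) ≤ 977 / 8000) ∧ (∀ z ∈ Literature.MathematicalPhysics.StatisticalMechanics.barlowStacking 1 (Real.sqrt (2 / 3)) s, dist (g (F z)) ((ptConfig Q) (transl Q ht p)) ≤ 2931 / 1000 → ∃ j, dist ((ptConfig Q) j) (g (F z)) ≤ 977 / 8000)) ↔
      (∃ (s : ℤ → ℤ) (F : EuclideanSpace ℝ (Fin 3) →L[ℝ] EuclideanSpace ℝ (Fin 3)) (g : EuclideanSpace ℝ (Fin 3) ≃ᵃⁱ[ℝ] EuclideanSpace ℝ (Fin 3)), Literature.MathematicalPhysics.StatisticalMechanics.IsHaggSeq s ∧ (∀ v : EuclideanSpace ℝ (Fin 3), ‖F v - (977 / 1000 : ℝ) • v‖ ≤ 977 / 10000 * ‖v‖) ∧ (∀ j k, j ≠ k → dist ((ptConfig Q) j) ((ptConfig Q) p) ≤ 2931 / 1000 → 977 / 2000 ≤ dist ((ptConfig Q) j) ((ptConfig Q) k)) ∧ (∀ j, dist ((ptConfig Q) j)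 ((ptConfig Q) p) ≤ 2931 / 1000 → ∃ z ∈ Literature.MathematicalPhysics.StatisticalMechanics.barlowStacking 1 (Real.sqrt (2 / 3)) s, dist ((ptConfig Q) j) (g (F z)) ≤ 977 / 8000) ∧ (∀ z ∈ Literature.MathematicalPhysics.StatisticalMechanics.barlowStacking 1 (Real.sqrt (2 / 3)) s, dist (g (F z)) ((ptConfig Q) p) ≤ 2931 / 1000 → ∃ j, dist ((ptConfig Q) j) (g (F z)) ≤ 977 / 8000)) := by
  rw [← nearBasin_comp_equiv_iff (ptConfig Q) (transl Q ht) p, ptConfig_comp_transl,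
    nearBasin_add_const_comp_iff]

/-- The near₂ predicate in `Q` is the same at all block points over the same motif point.
[folklore] -/
theorem nearBasin_toP_iff_motif (u : BIdx Q K) :
    (∃ (s : ℤ → ℤ) (F : EuclideanSpace ℝ (Fin 3) →L[ℝ] EuclideanSpace ℝ (Fin 3)) (g : EuclideanSpace ℝ (Fin 3) ≃ᵃⁱ[ℝ] EuclideanSpace ℝ (Fin 3)), Literature.MathematicalPhysics.StatisticalMechanics.IsHaggSeq s ∧ (∀ v : EuclideanSpace ℝ (Fin 3), ‖F v - (977 / 1000 : ℝ) • v‖ ≤ 977 / 10000 * ‖v‖) ∧ (∀ j k, j ≠ k → dist ((ptConfig Q) j) ((ptConfig Q) (toP Q K u)) ≤ 2931 / 1000 → 977 / 2000 ≤ dist ((ptConfig Q) j) ((ptConfig Q) k)) ∧ (∀ j, dist ((ptConfig Q) j) ((ptConfig Q) (toP Q K u)) ≤ 2931 / 1000 → ∃ z ∈ Literature.MathematicalPhysics.StatisticalMechanics.barlowStacking 1 (Real.sqrt (2 / 3)) s, dist ((ptConfig Q) j) (g (F z)) ≤ 977 / 8000) ∧ (∀ z ∈ Literature.MathematicalPhysics.StatisticalMechanics.barlowStacking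 1 (Real.sqrt (2 / 3)) s, dist (g (F z)) ((ptConfig Q) (toP Q K u)) ≤ 2931 / 1000 → ∃ j, dist ((ptConfig Q) j) (g (F z)) ≤ 977 / 8000)) ↔
      (∃ (s : ℤ → ℤ) (F : EuclideanSpace ℝ (Fin 3) →L[ℝ] EuclideanSpace ℝ (Fin 3)) (g : EuclideanSpace ℝ (Fin 3) ≃ᵃⁱ[ℝ] EuclideanSpace ℝ (Fin 3)), Literature.MathematicalPhysics.StatisticalMechanics.IsHaggSeq s ∧ (∀ v : EuclideanSpace ℝ (Fin 3), ‖F v - (977 / 1000 : ℝ) • v‖ ≤ 977 / 10000 * ‖v‖) ∧ (∀ j k, j ≠ k → dist ((ptConfig Q) j) ((ptConfig Q) ⟨u.1.1, Q.mem_points_of_mem_motif u.1.2⟩) ≤ 2931 / 1000 → 977 / 2000 ≤ dist ((ptConfig Q) j) ((ptConfig Q) k)) ∧ (∀ j, dist ((ptConfig Q) j) ((ptConfig Q) ⟨u.1.1, Q.mem_points_of_mem_motif u.1.2⟩) ≤ 2931 / 1000 → ∃ z ∈ Literature.MathematicalPhysics.StatisticalMechanics.barlowStacking 1 (Real.sqrt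 (2 / 3)) s, dist ((ptConfig Q) j) (g (F z)) ≤ 977 / 8000) ∧ (∀ z ∈ Literature.MathematicalPhysics.StatisticalMechanics.barlowStacking 1 (Real.sqrt (2 / 3)) s, dist (g (F z)) ((ptConfig Q) ⟨u.1.1, Q.mem_points_of_mem_motif u.1.2⟩) ≤ 2931 / 1000 → ∃ j, dist ((ptConfig Q) j) (g (F z)) ≤ 977 / 8000)) := by
  have h : toP Q K u = transl Q (latVec_mem Q (coords K u.2))
      ⟨u.1.1, Q.mem_points_of_mem_motif u.1.2⟩ := Subtype.ext rfl
  rw [h, nearBasin_transl_iff]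

/-- **The near₂ predicate of `(depth 4)`-deep block points is that of `Q`** (defect-far-site
locality at radius `357/100 < 4`, `mem_range_toP_of_deep`). [folklore] -/
theorem nearBasin_block_iff {u : BIdx Q K} (hu : IsDeep K (depth Q 4) u.2) :
    (∃ (s : ℤ → ℤ) (F : EuclideanSpace ℝ (Fin 3) →L[ℝ] EuclideanSpace ℝ (Fin 3)) (g : EuclideanSpace ℝ (Fin 3) ≃ᵃⁱ[ℝ] EuclideanSpace ℝ (Fin 3)), Literature.MathematicalPhysics.StatisticalMechanics.IsHaggSeq s ∧ (∀ v : EuclideanSpace ℝ (Fin 3), ‖F v - (977 / 1000 : ℝ) • v‖ ≤ 977 / 10000 * ‖v‖) ∧ (∀ j k, j ≠ k → dist ((bpt Q K) j) ((bpt Q K) u) ≤ 2931 / 1000 → 977 / 2000 ≤ dist ((bpt Q K) j) ((bpt Q K) k)) ∧ (∀ j, dist ((bpt Q K) j) ((bpt Q K) u) ≤ 2931 / 1000 → ∃ z ∈ Literature.MathematicalPhysics.StatisticalMechanics.barlowStacking 1 (Real.sqrt (2 / 3)) s, dist ((bpt Q K) j) (g (F z)) ≤ 977 / 8000) ∧ (∀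 z ∈ Literature.MathematicalPhysics.StatisticalMechanics.barlowStacking 1 (Real.sqrt (2 / 3)) s, dist (g (F z)) ((bpt Q K) u) ≤ 2931 / 1000 → ∃ j, dist ((bpt Q K) j) (g (F z)) ≤ 977 / 8000)) ↔
      (∃ (s : ℤ → ℤ) (F : EuclideanSpace ℝ (Fin 3) →L[ℝ] EuclideanSpace ℝ (Fin 3)) (g : EuclideanSpace ℝ (Fin 3) ≃ᵃⁱ[ℝ] EuclideanSpace ℝ (Fin 3)), Literature.MathematicalPhysics.StatisticalMechanics.IsHaggSeq s ∧ (∀ v : EuclideanSpace ℝ (Fin 3), ‖F v - (977 / 1000 : ℝ) • v‖ ≤ 977 / 10000 * ‖v‖) ∧ (∀ j k, j ≠ k → dist ((ptConfig Q) j) ((ptConfig Q) (toP Q K u)) ≤ 2931 / 1000 → 977 / 2000 ≤ dist ((ptConfig Q) j) ((ptConfig Q) k)) ∧ (∀ j, dist ((ptConfig Q) j) ((ptConfig Q) (toP Q K u)) ≤ 2931 / 1000 → ∃ z ∈ Literature.MathematicalPhysics.StatisticalMechanics.barlowStacking 1 (Real.sqrt (2 / 3)) s, dist ((ptConfig Q)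 j) (g (F z)) ≤ 977 / 8000) ∧ (∀ z ∈ Literature.MathematicalPhysics.StatisticalMechanics.barlowStacking 1 (Real.sqrt (2 / 3)) s, dist (g (F z)) ((ptConfig Q) (toP Q K u)) ≤ 2931 / 1000 → ∃ j, dist ((ptConfig Q) j) (g (F z)) ≤ 977 / 8000)) := by
  have hcomp : ptConfig Q ∘ toP Q K = bpt Q K := funext fun _ => rfl
  have key := nearBasin_apply_iff_comp (ptConfig Q) (toP_injective Q K) u
    (fun q hq => mem_range_toP_of_deep Q K hu q hq)
  rw [hcomp] at key
  exact key.symm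

/-- Far version: a `(depth 4)`-deep block point is defect-far in the block iff it is
defect-far in `Q`. [folklore] -/
theorem dfar_block_iff {u : BIdx Q K} (hu : IsDeep K (depth Q 4) u.2) :
    (¬ ∃ (s : ℤ → ℤ) (F : EuclideanSpace ℝ (Fin 3) →L[ℝ] EuclideanSpace ℝ (Fin 3)) (g : EuclideanSpace ℝ (Fin 3) ≃ᵃⁱ[ℝ] EuclideanSpace ℝ (Fin 3)), Literature.MathematicalPhysics.StatisticalMechanics.IsHaggSeq s ∧ (∀ v : EuclideanSpace ℝ (Fin 3), ‖F v - (977 / 1000 : ℝ) • v‖ ≤ 977 / 10000 * ‖v‖) ∧ (∀ j k, j ≠ k → dist ((bpt Q K) j) ((bpt Q K) u) ≤ 2931 / 1000 → 977 / 2000 ≤ dist ((bpt Q K) j) ((bpt Q K) k)) ∧ (∀ j, dist ((bpt Q K) j) ((bpt Q K) u) ≤ 2931 / 1000 → ∃ z ∈ Literature.MathematicalPhysics.StatisticalMechanics.barlowStacking 1 (Real.sqrt (2 / 3)) s, dist ((bpt Q K) j) (g (F z)) ≤ 977 / 8000) ∧ (∀ z ∈ Literature.MathematicalPhysics.StatisticalMechanics.barlowStacking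 1 (Real.sqrt (2 / 3)) s, dist (g (F z)) ((bpt Q K) u) ≤ 2931 / 1000 → ∃ j, dist ((bpt Q K) j) (g (F z)) ≤ 977 / 8000)) ↔
      (¬ ∃ (s : ℤ → ℤ) (F : EuclideanSpace ℝ (Fin 3) →L[ℝ] EuclideanSpace ℝ (Fin 3)) (g : EuclideanSpace ℝ (Fin 3) ≃ᵃⁱ[ℝ] EuclideanSpace ℝ (Fin 3)), Literature.MathematicalPhysics.StatisticalMechanics.IsHaggSeq s ∧ (∀ v : EuclideanSpace ℝ (Fin 3), ‖F v - (977 / 1000 : ℝ) • v‖ ≤ 977 / 10000 * ‖v‖) ∧ (∀ j k, j ≠ k → dist ((ptConfig Q) j) ((ptConfig Q) (toP Q K u)) ≤ 2931 / 1000 → 977 / 2000 ≤ dist ((ptConfig Q) j) ((ptConfig Q) k)) ∧ (∀ j, dist ((ptConfig Q) j) ((ptConfig Q) (toP Q K u)) ≤ 2931 / 1000 → ∃ z ∈ Literature.MathematicalPhysics.StatisticalMechanics.barlowStacking 1 (Real.sqrt (2 / 3)) s, dist ((ptConfig Q) j) (g (F z)) ≤ 977 / 8000) ∧ (∀ z ∈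 Literature.MathematicalPhysics.StatisticalMechanics.barlowStacking 1 (Real.sqrt (2 / 3)) s, dist (g (F z)) ((ptConfig Q) (toP Q K u)) ≤ 2931 / 1000 → ∃ j, dist ((ptConfig Q) j) (g (F z)) ≤ 977 / 8000)) :=
  not_congr (nearBasin_block_iff Q K hu)

/-- The number of block points (indexed by `BIdx`) that are defect-far in the BLOCK is at
least `#((depth 4)-deep lattice coordinates) · #(defect-far motif sites of Q)`. [folklore] -/
theorem dfar_card_block_ge :
    Nat.card {k : Fin 3 → Fin K // IsDeep K (depth Q 4) k} *
        Nat.card {x : Q.motif // ¬ ∃ (s : ℤ → ℤ) (F : EuclideanSpace ℝ (Fin 3) →L[ℝ] EuclideanSpace ℝ (Fin 3)) (g : EuclideanSpace ℝ (Fin 3) ≃ᵃⁱ[ℝ] EuclideanSpace ℝ (Fin 3)), Literature.MathematicalPhysics.StatisticalMechanics.IsHaggSeq s ∧ (∀ v : EuclideanSpace ℝ (Fin 3), ‖F v - (977 / 1000 : ℝ) • v‖ ≤ 977 / 10000 * ‖v‖) ∧ (∀ j k : Q.points, j ≠ k → dist ((Subtype.val : Q.points → EuclideanSpace ℝ (Fin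 3)) j) ((Subtype.val : Q.points → EuclideanSpace ℝ (Fin 3)) ⟨x.1, Q.mem_points_of_mem_motif x.2⟩) ≤ 2931 / 1000 → 977 / 2000 ≤ dist ((Subtype.val : Q.points → EuclideanSpace ℝ (Fin 3)) j) ((Subtype.val : Q.points → EuclideanSpace ℝ (Fin 3)) k)) ∧ (∀ j : Q.points, dist ((Subtype.val : Q.points → EuclideanSpace ℝ (Fin 3)) j) ((Subtype.val : Q.points → EuclideanSpace ℝ (Fin 3)) ⟨x.1, Q.mem_points_of_mem_motif x.2⟩) ≤ 2931 / 1000 → ∃ z ∈ Literature.MathematicalPhysics.StatisticalMechanics.barlowStacking 1 (Real.sqrt (2 / 3)) s, dist ((Subtype.val : Q.points → EuclideanSpace ℝ (Fin 3)) j) (g (F z)) ≤ 977 / 8000) ∧ (∀ z ∈ Literature.MathematicalPhysics.StatisticalMechanics.barlowStacking 1 (Real.sqrt (2 / 3)) s, dist (g (F z)) ((Subtype.val : Q.points → EuclideanSpace ℝ (Fin 3)) ⟨x.1, Q.mem_points_of_mem_motif x.2⟩) ≤ 2931 / 1000 → ∃ j : Q.points, dist ((Subtype.val : Q.points → EuclideanSpace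 ℝ (Fin 3)) j) (g (F z)) ≤ 977 / 8000)} ≤
      Nat.card {u : BIdx Q K // ¬ ∃ (s : ℤ → ℤ) (F : EuclideanSpace ℝ (Fin 3) →L[ℝ] EuclideanSpace ℝ (Fin 3)) (g : EuclideanSpace ℝ (Fin 3) ≃ᵃⁱ[ℝ] EuclideanSpace ℝ (Fin 3)), Literature.MathematicalPhysics.StatisticalMechanics.IsHaggSeq s ∧ (∀ v : EuclideanSpace ℝ (Fin 3), ‖F v - (977 / 1000 : ℝ) • v‖ ≤ 977 / 10000 * ‖v‖) ∧ (∀ j k, j ≠ k → dist ((bpt Q K) j) ((bpt Q K) u) ≤ 2931 / 1000 → 977 / 2000 ≤ dist ((bpt Q K) j) ((bpt Q K) k)) ∧ (∀ j, dist ((bpt Q K) j) ((bpt Q K) u) ≤ 2931 / 1000 → ∃ z ∈ Literature.MathematicalPhysics.StatisticalMechanics.barlowStacking 1 (Real.sqrt (2 / 3)) s, dist ((bpt Q K) j) (g (F z)) ≤ 977 / 8000) ∧ (∀ z ∈ Literature.MathematicalPhysics.StatisticalMechanics.barlowStacking 1 (Real.sqrt (2 / 3)) s, dist (g (F z)) ((bpt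 Q K) u) ≤ 2931 / 1000 → ∃ j, dist ((bpt Q K) j) (g (F z)) ≤ 977 / 8000)} := by
  classical
  let f : {k : Fin 3 → Fin K // IsDeep K (depth Q 4) k} ×
      {x : Q.motif // ¬ ∃ (s : ℤ → ℤ) (F : EuclideanSpace ℝ (Fin 3) →L[ℝ] EuclideanSpace ℝ (Fin 3)) (g : EuclideanSpace ℝ (Fin 3) ≃ᵃⁱ[ℝ] EuclideanSpace ℝ (Fin 3)), Literature.MathematicalPhysics.StatisticalMechanics.IsHaggSeq s ∧ (∀ v : EuclideanSpace ℝ (Fin 3), ‖F v - (977 / 1000 : ℝ) • v‖ ≤ 977 / 10000 * ‖v‖) ∧ (∀ j k : Q.points, j ≠ k → dist ((Subtype.val : Q.points → EuclideanSpace ℝ (Fin 3)) j) ((Subtype.val : Q.points → EuclideanSpace ℝ (Fin 3)) ⟨x.1, Q.mem_points_of_mem_motif x.2⟩) ≤ 2931 / 1000 → 977 / 2000 ≤ dist ((Subtype.val : Q.points → EuclideanSpace ℝ (Fin 3)) j) ((Subtype.val : Q.points → EuclideanSpace ℝ (Fin 3)) k)) ∧ (∀ j : Q.points, dist ((Subtype.val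 : Q.points → EuclideanSpace ℝ (Fin 3)) j) ((Subtype.val : Q.points → EuclideanSpace ℝ (Fin 3)) ⟨x.1, Q.mem_points_of_mem_motif x.2⟩) ≤ 2931 / 1000 → ∃ z ∈ Literature.MathematicalPhysics.StatisticalMechanics.barlowStacking 1 (Real.sqrt (2 / 3)) s, dist ((Subtype.val : Q.points → EuclideanSpace ℝ (Fin 3)) j) (g (F z)) ≤ 977 / 8000) ∧ (∀ z ∈ Literature.MathematicalPhysics.StatisticalMechanics.barlowStacking 1 (Real.sqrt (2 / 3)) s, dist (g (F z)) ((Subtype.val : Q.points → EuclideanSpace ℝ (Fin 3)) ⟨x.1, Q.mem_points_of_mem_motif x.2⟩) ≤ 2931 / 1000 → ∃ j : Q.points, dist ((Subtype.val : Q.points → EuclideanSpace ℝ (Fin 3)) j) (g (F z)) ≤ 977 / 8000)} →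
      {u : BIdx Q K // ¬ ∃ (s : ℤ → ℤ) (F : EuclideanSpace ℝ (Fin 3) →L[ℝ] EuclideanSpace ℝ (Fin 3)) (g : EuclideanSpace ℝ (Fin 3) ≃ᵃⁱ[ℝ] EuclideanSpace ℝ (Fin 3)), Literature.MathematicalPhysics.StatisticalMechanics.IsHaggSeq s ∧ (∀ v : EuclideanSpace ℝ (Fin 3), ‖F v - (977 / 1000 : ℝ) • v‖ ≤ 977 / 10000 * ‖v‖) ∧ (∀ j k, j ≠ k → dist ((bpt Q K) j) ((bpt Q K) u) ≤ 2931 / 1000 → 977 / 2000 ≤ dist ((bpt Q K) j) ((bpt Q K) k)) ∧ (∀ j, dist ((bpt Q K) j) ((bpt Q K) u) ≤ 2931 / 1000 → ∃ z ∈ Literature.MathematicalPhysics.StatisticalMechanics.barlowStacking 1 (Real.sqrt (2 / 3)) s, dist ((bpt Q K) j) (g (F z)) ≤ 977 / 8000) ∧ (∀ z ∈ Literature.MathematicalPhysics.StatisticalMechanics.barlowStacking 1 (Real.sqrt (2 / 3)) s, dist (g (F z)) ((bpt Q K) u) ≤ 2931 / 1000 → ∃ j, dist ((bpt Q K) j)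 (g (F z)) ≤ 977 / 8000)} :=
    fun p => ⟨(p.2.1, p.1.1), by
      rw [dfar_block_iff Q K (u := (p.2.1, p.1.1)) p.1.2, nearBasin_toP_iff_motif]
      exact p.2.2⟩
  have hf : Function.Injective f := by
    rintro ⟨⟨k, hk⟩, ⟨x, hx⟩⟩ ⟨⟨k', hk'⟩, ⟨x', hx'⟩⟩ h
    have h' := congrArg (fun w => w.1) h
    simp only [f] at h'
    obtain ⟨rfl, rfl⟩ := Prod.ext_iff.1 h'
    rfl
  have := Nat.card_le_card_of_injective f hf
  rw [Nat.card_prod] at this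
  exact this

/-- The block configuration (indexed by `Fin (#F K³)`) has as many defect-far sites as the
block indexed by `BIdx`. [folklore] -/
theorem dfar_blockConfig_eq :
    Nat.card {i : Fin (Fintype.card (BIdx Q K)) // ¬ ∃ (s : ℤ → ℤ) (F : EuclideanSpace ℝ (Fin 3) →L[ℝ] EuclideanSpace ℝ (Fin 3)) (g : EuclideanSpace ℝ (Fin 3) ≃ᵃⁱ[ℝ] EuclideanSpace ℝ (Fin 3)), Literature.MathematicalPhysics.StatisticalMechanics.IsHaggSeq s ∧ (∀ v : EuclideanSpace ℝ (Fin 3), ‖F v - (977 / 1000 : ℝ) • v‖ ≤ 977 / 10000 * ‖v‖) ∧ (∀ j k, j ≠ k → dist ((blockConfig Q K) j) ((blockConfig Q K) i) ≤ 2931 / 1000 → 977 / 2000 ≤ dist ((blockConfig Q K) j) ((blockConfig Q K) k)) ∧ (∀ j, dist ((blockConfig Q K) j) ((blockConfig Q K) i) ≤ 2931 / 1000 → ∃ z ∈ Literature.MathematicalPhysics.StatisticalMechanics.barlowStacking 1 (Real.sqrt (2 / 3)) s, dist ((blockConfig Q K) j) (g (F z)) ≤ 977 / 8000) ∧ (∀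 z ∈ Literature.MathematicalPhysics.StatisticalMechanics.barlowStacking 1 (Real.sqrt (2 / 3)) s, dist (g (F z)) ((blockConfig Q K) i) ≤ 2931 / 1000 → ∃ j, dist ((blockConfig Q K) j) (g (F z)) ≤ 977 / 8000)} =
      Nat.card {u : BIdx Q K // ¬ ∃ (s : ℤ → ℤ) (F : EuclideanSpace ℝ (Fin 3) →L[ℝ] EuclideanSpace ℝ (Fin 3)) (g : EuclideanSpace ℝ (Fin 3) ≃ᵃⁱ[ℝ] EuclideanSpace ℝ (Fin 3)), Literature.MathematicalPhysics.StatisticalMechanics.IsHaggSeq s ∧ (∀ v : EuclideanSpace ℝ (Fin 3), ‖F v - (977 / 1000 : ℝ) • v‖ ≤ 977 / 10000 * ‖v‖) ∧ (∀ j k, j ≠ k → dist ((bpt Q K) j) ((bpt Q K) u) ≤ 2931 / 1000 → 977 / 2000 ≤ dist ((bpt Q K) j) ((bpt Q K) k)) ∧ (∀ j, dist ((bpt Q K) j) ((bpt Q K) u) ≤ 2931 / 1000 → ∃ z ∈ Literature.MathematicalPhysics.StatisticalMechanics.barlowStacking 1 (Real.sqrt (2 / 3)) s, dist ((bpt Q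 K) j) (g (F z)) ≤ 977 / 8000) ∧ (∀ z ∈ Literature.MathematicalPhysics.StatisticalMechanics.barlowStacking 1 (Real.sqrt (2 / 3)) s, dist (g (F z)) ((bpt Q K) u) ≤ 2931 / 1000 → ∃ j, dist ((bpt Q K) j) (g (F z)) ≤ 977 / 8000)} := by
  rw [blockConfig]
  exact dfar_card_comp_equiv (bpt Q K) (Fintype.equivFin (BIdx Q K)).symm

end BlockCount

/-! ## (FAR₂) ⇒ the periodic defect-far-site pricing (blocks) -/

/-- **The defect far-site gap implies the periodic defect-far-site pricing** (same `κ`):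
apply (FAR₂) to the blocks `blockConfig Q K`; `(depth Q 4)`-deep block points over defect-far
motif points are defect-far in the block, non-deep lattice coordinates are `≤ 6 · depth · K²`,
and blocks are `V_χ`-trial states (`exists_block_energy_le_truncLJ`); the arithmetic is the
template's `pricing_of_blockEstimates`. [folklore] -/
theorem periodicDefectFarPricing_of_defectFarSiteGap : (∃ κ : ℝ, 0 < κ ∧ ∀ (N : ℕ) (y : Fin N → EuclideanSpace ℝ (Fin 3)), Function.Injective y → (N : ℝ) * (⨅ Q : Literature.MathematicalPhysics.StatisticalMechanics.PeriodicConfiguration 3, Q.energyPerParticle (fun r => min 1 (max 0 (4 - 2 * r)) * Literature.MathematicalPhysics.StatisticalMechanics.lennardJones r)) + κ * (Nat.card {i : Fin N // ¬ ∃ (s : ℤ → ℤ) (F : EuclideanSpace ℝ (Fin 3) →L[ℝ] EuclideanSpace ℝ (Fin 3)) (g : EuclideanSpace ℝ (Fin 3) ≃ᵃⁱ[ℝ] EuclideanSpace ℝ (Fin 3)), Literature.MathematicalPhysics.StatisticalMechanics.IsHaggSeq s ∧ (∀ v : EuclideanSpace ℝ (Fin 3), ‖F v - (977 / 1000 : ℝ)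 • v‖ ≤ 977 / 10000 * ‖v‖) ∧ (∀ j k : Fin N, j ≠ k → dist (y j) (y i) ≤ 2931 / 1000 → 977 / 2000 ≤ dist (y j) (y k)) ∧ (∀ j : Fin N, dist (y j) (y i) ≤ 2931 / 1000 → ∃ z ∈ Literature.MathematicalPhysics.StatisticalMechanics.barlowStacking 1 (Real.sqrt (2 / 3)) s, dist (y j) (g (F z)) ≤ 977 / 8000) ∧ (∀ z ∈ Literature.MathematicalPhysics.StatisticalMechanics.barlowStacking 1 (Real.sqrt (2 / 3)) s, dist (g (F z)) (y i) ≤ 2931 / 1000 → ∃ j : Fin N, dist (y j) (g (F z)) ≤ 977 / 8000)} : ℝ) ≤ Literature.MathematicalPhysics.StatisticalMechanics.interactionEnergy (fun r => min 1 (max 0 (4 - 2 * r)) * Literature.MathematicalPhysics.StatisticalMechanics.lennardJones r) y) → (∃ κ : ℝ, 0 < κ ∧ ∀ Q : Literature.MathematicalPhysics.StatisticalMechanics.PeriodicConfiguration 3, κ * (Nat.card {x : Q.motif // ¬ ∃ (s : ℤ → ℤ) (F : EuclideanSpace ℝ (Fin 3) →L[ℝ] EuclideanSpace ℝ (Fin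 3)) (g : EuclideanSpace ℝ (Fin 3) ≃ᵃⁱ[ℝ] EuclideanSpace ℝ (Fin 3)), Literature.MathematicalPhysics.StatisticalMechanics.IsHaggSeq s ∧ (∀ v : EuclideanSpace ℝ (Fin 3), ‖F v - (977 / 1000 : ℝ) • v‖ ≤ 977 / 10000 * ‖v‖) ∧ (∀ j k : Q.points, j ≠ k → dist ((Subtype.val : Q.points → EuclideanSpace ℝ (Fin 3)) j) ((Subtype.val : Q.points → EuclideanSpace ℝ (Fin 3)) ⟨x.1, Q.mem_points_of_mem_motif x.2⟩) ≤ 2931 / 1000 → 977 / 2000 ≤ dist ((Subtype.val : Q.points → EuclideanSpace ℝ (Fin 3)) j) ((Subtype.val : Q.points → EuclideanSpace ℝ (Fin 3)) k)) ∧ (∀ j : Q.points, dist ((Subtype.val : Q.points → EuclideanSpace ℝ (Fin 3)) j) ((Subtype.val : Q.points → EuclideanSpace ℝ (Fin 3)) ⟨x.1, Q.mem_points_of_mem_motif x.2⟩) ≤ 2931 / 1000 → ∃ z ∈ Literature.MathematicalPhysics.StatisticalMechanics.barlowStacking 1 (Real.sqrt (2 / 3)) s, dist ((Subtype.val : Q.points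 → EuclideanSpace ℝ (Fin 3)) j) (g (F z)) ≤ 977 / 8000) ∧ (∀ z ∈ Literature.MathematicalPhysics.StatisticalMechanics.barlowStacking 1 (Real.sqrt (2 / 3)) s, dist (g (F z)) ((Subtype.val : Q.points → EuclideanSpace ℝ (Fin 3)) ⟨x.1, Q.mem_points_of_mem_motif x.2⟩) ≤ 2931 / 1000 → ∃ j : Q.points, dist ((Subtype.val : Q.points → EuclideanSpace ℝ (Fin 3)) j) (g (F z)) ≤ 977 / 8000)} : ℝ) ≤ (Q.motif.card : ℝ) * (Q.energyPerParticle (fun r => min 1 (max 0 (4 - 2 * r)) * Literature.MathematicalPhysics.StatisticalMechanics.lennardJones r) - ⨅ Q' : Literature.MathematicalPhysics.StatisticalMechanics.PeriodicConfiguration 3, Q'.energyPerParticle (fun r => min 1 (max 0 (4 - 2 * r)) * Literature.MathematicalPhysics.StatisticalMechanics.lennardJones r))) := by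
  rintro ⟨κ, hκ, hgap⟩
  refine ⟨κ, hκ, fun Q => ?_⟩
  refine pricing_of_blockEstimates (L := depth Q 4) hκ Q.motif_nonempty.card_pos ?_
  intro ε hε
  obtain ⟨K₀, hK₀, hK⟩ := exists_block_energy_le_truncLJ Q ε hε
  refine ⟨K₀, hK₀, fun K hKK₀ => ?_⟩
  have hn : ((Fintype.card (BIdx Q K) : ℕ) : ℝ) = (Q.motif.card : ℝ) * (K : ℝ) ^ 3 := by
    exact_mod_cast card_BIdx Q K
  refine ⟨Nat.card {u : BIdx Q K // ¬ ∃ (s : ℤ → ℤ) (F : EuclideanSpace ℝ (Fin 3) →L[ℝ] EuclideanSpace ℝ (Fin 3)) (g : EuclideanSpace ℝ (Fin 3) ≃ᵃⁱ[ℝ] EuclideanSpace ℝ (Fin 3)), Literature.MathematicalPhysics.StatisticalMechanics.IsHaggSeq s ∧ (∀ v : EuclideanSpace ℝ (Fin 3), ‖F v - (977 / 1000 : ℝ) • v‖ ≤ 977 / 10000 * ‖v‖) ∧ (∀ j k, j ≠ k → dist ((bpt Q K) j) ((bpt Q K) u) ≤ 2931 / 1000 → 977 / 2000 ≤ dist ((bpt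 Q K) j) ((bpt Q K) k)) ∧ (∀ j, dist ((bpt Q K) j) ((bpt Q K) u) ≤ 2931 / 1000 → ∃ z ∈ Literature.MathematicalPhysics.StatisticalMechanics.barlowStacking 1 (Real.sqrt (2 / 3)) s, dist ((bpt Q K) j) (g (F z)) ≤ 977 / 8000) ∧ (∀ z ∈ Literature.MathematicalPhysics.StatisticalMechanics.barlowStacking 1 (Real.sqrt (2 / 3)) s, dist (g (F z)) ((bpt Q K) u) ≤ 2931 / 1000 → ∃ j, dist ((bpt Q K) j) (g (F z)) ≤ 977 / 8000)},
    Nat.card {k : Fin 3 → Fin K // IsDeep K (depth Q 4) k},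
    interactionEnergy (fun r => min 1 (max 0 (4 - 2 * r)) * lennardJones r) (blockConfig Q K),
    ?_, ?_, ?_, ?_⟩
  · have h := hgap _ (blockConfig Q K) (blockConfig_injective Q K)
    rw [dfar_blockConfig_eq, hn] at h
    exact h
  · have h := hK K hKK₀
    rw [hn] at h
    exact h
  · exact dfar_card_block_ge Q K
  · exact card_deep_ge K (depth Q 4)

end Summit.AtomisticToContinuum.Crystallization.Theorems.PricedLinkCensusTruncatedCensusGap

end
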